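import Literature.MathematicalPhysics.QuantumFieldTheory.Balaban1983to89.B10Eq18SigmaSU2
import Mathlib.LinearAlgebra.Matrix.Charpoly.Eigs
import Literature.MathematicalPhysics.QuantumFieldTheory.Balaban1983to89.B13SigmaRelEigenvalues

/-!
# `Balaban1983to89.B10Eq18SigmaSU2Eigenvalues` — T. Bałaban, *Ultraviolet stability of three-dimensional lattice pure
# gauge field theories*, Commun. Math. Phys. **102** (1985) 255–275 [Balaban1985UV3], p. 260, the SU(2) example
# «σ(A) = 1/2π² (sin|A|/|A|)², … A = Σ_{a=1}^3 σ_aA^a»: THE EIGENVALUE DICTIONARY «the eigenvalues of ad(iA) on su(2) are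
# 0, ±2i|A|» — RECORDED, not proved, in the audit module `B13HaarSigma` §3 — PROVED in print's Pauli coordinates, with
# multiplicities, and the «computed two ways» loop of `B13HaarSigma` §3 closed at the example:
# `σrel(T_A) = det φ(T_A) = φ(0)·φ(2i|A|)·φ(−2i|A|) = ∏_{λ ∈ roots of charpoly(T_A)} φ(λ)`

statement-level skeleton of published theorems with citation tags; proofs where landed; nothing here is a claim
about the Yang–Mills mass gap

PDF held: `paper:balaban1985-cmp102-uv-stability-3d`; p. 260 [PDF 6] re-read by this seat from the x2 render
`pub-balaban/b2b-balaban-ref1/pages/1985-cmp102-uv-stability-3d/1985-cmp102-uv-stability-3d-p006-x2.png` (2026-08-22).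

THE PRINTED TEXT.  p. 260 (verbatim): *"For example for SU(2) we have σ(A) = 1/2π² (sin|A|/|A|)², where |A| = Σ_{a=1}^{3}
(A^a)² ⟦sic: the square root is not printed⟧, and an element A of the Lie algebra is represented as A = Σ_{a=1}^{3} σ_aA^a,
σ_a are the three Pauli matrices (generators of the Lie algebra)."*  In the dictionary `σ(A)/σ₀ = det φ(−ad iA)` of
[Hel] = [Helgason2000] Ch. I §1 Thm. 1.14 (12) (`B13HaarSigma.sigmaRel`; for SU(2) the identification with the Haar
density is the tree's `B10Eq18SigmaSU2Haar`), the audit module `B13HaarSigma` §3 computed the example «two ways» at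
SCALAR level, `φ(0)·φ(2ir)·φ(−2ir) = (sin r/r)²` (`su2_scalar_check`), and RECORDED as not proved the dictionary that
makes this the determinant: «the eigenvalues of `ad A` on `su(2)` are `0, ±2i|A|` for `A = Σ σ_a A^a`».

WHAT IS REPRODUCED.  Mega-formalization `lit-balaban` (HOME `run/shared/lean/pub/lit-balaban/`), unit `lit-balaban-r07`
gen 18, file 2.  SKELETON rows: narrative display E18 of `lit-balaban-r07/ROWS-B10.md` §2 (row of record **B10.Eq21**).
The sibling `B10Eq18SigmaSU2` (same seat, gen 17) proved the printed value `σrel(T_A) = (sin|A|/|A|)²` for the matrix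
`T_A = 2[A]_×` OF `−ad(iA)` IN THE PAULI COORDINATES (`adMat_su2Coord`: `ad(X(x))X(y) = X(−2[x]_× y)`, `X(x) = iΣ x_aσ_a`,
`X : ℝ³ ≅ su(2)` by `su2Coord_injective`/`exists_su2Coord_eq`) through the cubic relation `[A]_׳ = −|A|²[A]_×`, bypassing
the eigenvalues.  THIS FILE supplies the recorded dictionary itself and closes the loop:
* §1 `charpoly([c]_×) = X³ + (c·c)X` for the cross-product matrix over any commutative ring (`charpoly_crossMatrix`),
  `[a•c]_× = a•[c]_×`;
* §2 for real `A` with `A·A = r²`: `charpoly(T_A) = X³ + (2r)²X = X(X − 2ri)(X + 2ri)` (`charpoly_TA`, `charpoly_TA_eq_mul`),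
  hence **the roots WITH MULTIPLICITIES are `{0, 2ri, −2ri}`** (`roots_charpoly_TA`) and **the spectrum of `T_A` is
  `{0, 2i|A|, −2i|A|}`** (`spectrum_TA`; Mathlib `Matrix.mem_spectrum_iff_isRoot_charpoly`) — the eigenvalue dictionary of
  `B13HaarSigma` §3 for the matrix of `−ad(iA)` (equivalently of `ad(iA)`: the set is symmetric) in print's coordinates;
* §3 **the loop closed at the example**: `σrel(T_A) = φ(0)·φ(2i|A|)·φ(−2i|A|)` (`sigmaRel_TA_eq_phi_mul`, from the sibling's
  `sigmaRel_su2` and `B13HaarSigma.su2_scalar_check` — the two independently computed values agree) and, uniformly in `A`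
  (including `A = 0`, where `charpoly = X³`, `σrel = φ(0)³ = 1`),
  **`σrel(T_A) = ∏_{λ ∈ roots charpoly(T_A)} φ(λ)`** as a multiset product (`sigmaRel_TA_eq_prod_roots`) — the general
  «`det φ(T) = Π_λ φ(λ)` over the eigenvalues» of `B13HaarSigma` §3 AT THIS `T`;
* (v1.1, APPEND-ONLY §4) **BY NAME from p28's `B13SigmaRelEigenvalues`** (landed while v1 was in the gate): the general
  `sigmaRel_eq_prod_roots` ([Rossmann2002] §1.2 Lemma 6 with multiplicities) subsumes `sigmaRel_TA_eq_prod_roots`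
  (`sigmaRel_TA_eq_prod_roots'`, one line), and its `sigmaRel_eq_sin_sq_of_roots` fed with §2's `roots_charpoly_TA` gives
  print's `(sin|A|/|A|)²` a THIRD way (`sigmaRel_TA_eq_sin_sq_byRoots`; first: `B13HaarSigma.su2_scalar_check` + recorded
  dictionary; second: the sibling's cubic-relation route `sigmaRel_su2`) — the three seats' routes agree by name.

HONEST SCOPE.  (i) Coordinates: the statements are about the complex `3 × 3` matrix `T_A` (print's coordinates `A^a`);
the endomorphism `ad(iA)` of the subtype `↥su(2)` and its complexification are reached through the sibling's coordinate
isomorphism `X` (`adMat_su2Coord`, `exists_su2Coord_eq`, `su2Coord_injective`), not through a `Module.Basis` object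
(r10's `B13HaarSigmaJacobian` v1.1, in review at the time of writing, builds that basis — `su2Basis`, `toMatrix_adg_su2`:
`[ad_𝔤(iA)]_b = −2[A]_×` — so the spectrum statements below transfer verbatim to the endomorphism).
(ii) The general identity `det f(T) = ∏ f(λ_j)` for power series `f` (Rossmann §1.2 Lemma 6 with multiplicities) is NOT
proved here — it is seat p28's `PowerSeriesEigenvalueMultiplicities` / `B13SigmaRelEigenvalues` (p319776); §3 is the
instance at `T_A` obtained from the two closed forms, §4 (v1.1) the same instance and the printed value BY NAME from p28.  (iii) Nothing of `B13HaarSigma`, `B10Eq18SigmaSU2`, `B13HaarSigmaJacobian`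
is re-proved.  0 definitions, 0 new named facts.
-/

noncomputable section

open Polynomial Matrix

namespace Literature.MathematicalPhysics.QuantumFieldTheory.Balaban1983to89.B10Eq18SigmaSU2Eigenvalues

open B13HaarSigma B10Eq18SigmaSU2

/-! ## §1  The characteristic polynomial of the cross-product matrix -/

section CrossMatrix

variable {R : Type*} [CommRing R]

/-- **`charpoly([c]_×) = X³ + (c·c)·X`** for the cross-product matrix `[c]_×` (`B10Eq18SigmaSU2.crossMatrix`) over any
commutative ring — the characteristic polynomial of an infinitesimal rotation. [cite: Balaban1985UV3, p. 260] -/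
theorem charpoly_crossMatrix (c : Fin 3 → R) :
    (crossMatrix c).charpoly = X ^ 3 + C (dotProduct c c) * X := by
  simp [Matrix.charpoly, Matrix.det_fin_three, crossMatrix, dotProduct, Fin.sum_univ_three]
  ring

/-- `[a•c]_× = a•[c]_×` (linearity of the cross-product matrix in `c`). [cite: Balaban1985UV3, p. 260] -/
theorem crossMatrix_smul (a : R) (c : Fin 3 → R) : crossMatrix (a • c) = a • crossMatrix c := by
  ext i j
  fin_cases i <;> fin_cases j <;> simp [crossMatrix]

end CrossMatrix

/-! ## §2  The eigenvalues of `T_A = 2[A]_×` (the matrix of `−ad(iA)` in the Pauli coordinates): `0, ±2i|A|` -/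

section Spectrum

open Complex

/-- The complexified matrix `T_A = 2[A]_× ⊗ ℂ` of the sibling file is the cross-product matrix of the complex vector
`2A`. [cite: Balaban1985UV3, p. 260] -/
theorem TA_eq_crossMatrix (A : Fin 3 → ℝ) :
    ((2 : ℝ) • crossMatrix A).map (algebraMap ℝ ℂ) = crossMatrix (fun i => ((2 * A i : ℝ) : ℂ)) := by
  ext i j
  fin_cases i <;> fin_cases j <;> simp [crossMatrix]

/-- `(2A)·(2A) = (2r)²` in `ℂ` when `A·A = r²`. [folklore] -/
private theorem dotProduct_two_mul {A : Fin 3 → ℝ} {r : ℝ} (hA : dotProduct A A = r ^ 2) :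
    dotProduct (fun i => ((2 * A i : ℝ) : ℂ)) (fun i => ((2 * A i : ℝ) : ℂ)) = ((2 * r : ℝ) : ℂ) ^ 2 := by
  have h : dotProduct (fun i => 2 * A i) (fun i => 2 * A i) = (2 * r) ^ 2 := by
    simp only [dotProduct, Fin.sum_univ_three] at hA ⊢
    nlinarith [hA]
  have h' := congrArg (fun t : ℝ => (t : ℂ)) h
  simpa [dotProduct, Fin.sum_univ_three] using h'

/-- **`charpoly(T_A) = X³ + (2r)²·X`** for `A·A = r²` (`T_A = 2[A]_×` cast to `ℂ`). [cite: Balaban1985UV3, p. 260] -/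
theorem charpoly_TA {A : Fin 3 → ℝ} {r : ℝ} (hA : dotProduct A A = r ^ 2) :
    (((2 : ℝ) • crossMatrix A).map (algebraMap ℝ ℂ)).charpoly = X ^ 3 + C (((2 * r : ℝ) : ℂ) ^ 2) * X := by
  rw [TA_eq_crossMatrix, charpoly_crossMatrix, dotProduct_two_mul hA]

/-- **`charpoly(T_A) = X·(X − 2ri)·(X + 2ri)`** — the factorisation over `ℂ` (`(2ri)² = −(2r)²`). [cite: Balaban1985UV3, p. 260] -/
theorem charpoly_TA_eq_mul {A : Fin 3 → ℝ} {r : ℝ} (hA : dotProduct A A = r ^ 2) :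
    (((2 : ℝ) • crossMatrix A).map (algebraMap ℝ ℂ)).charpoly =
      X * ((X - C (((2 * r : ℝ) : ℂ) * I)) * (X + C (((2 * r : ℝ) : ℂ) * I))) := by
  rw [charpoly_TA hA]
  have hI : C (((2 * r : ℝ) : ℂ) * I) * C (((2 * r : ℝ) : ℂ) * I) = -C (((2 * r : ℝ) : ℂ) ^ 2) := by
    rw [← C_mul, ← C_neg]
    congr 1
    rw [mul_mul_mul_comm, Complex.I_mul_I]
    ring
  linear_combination (X : ℂ[X]) * hI

/-- **THE EIGENVALUE DICTIONARY WITH MULTIPLICITIES: the roots of `charpoly(T_A)` are `{0, 2ri, −2ri}`** as a multiset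
(`r² = A·A`, so `r = ±|A|`; each root simple for `A ≠ 0`, a triple root `0` for `A = 0`) — «the eigenvalues of `ad(iA)` on
`su(2)` are `0, ±2i|A|`» (`B13HaarSigma` §3, recorded there as not proved) for the matrix `T_A` of `−ad(iA)` in the Pauli
coordinates (`B10Eq18SigmaSU2.adMat_su2Coord`). [cite: Balaban1985UV3, p. 260] -/
theorem roots_charpoly_TA {A : Fin 3 → ℝ} {r : ℝ} (hA : dotProduct A A = r ^ 2) :
    (((2 : ℝ) • crossMatrix A).map (algebraMap ℝ ℂ)).charpoly.roots =
      {0, ((2 * r : ℝ) : ℂ) * I, -(((2 * r : ℝ) : ℂ) * I)} := by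
  rw [charpoly_TA_eq_mul hA]
  have h1 : (X - C (((2 * r : ℝ) : ℂ) * I)) ≠ 0 := X_sub_C_ne_zero _
  have h2 : (X + C (((2 * r : ℝ) : ℂ) * I)) ≠ 0 := by
    rw [← sub_neg_eq_add, ← C_neg]
    exact X_sub_C_ne_zero _
  have h12 : (X - C (((2 * r : ℝ) : ℂ) * I)) * (X + C (((2 * r : ℝ) : ℂ) * I)) ≠ 0 := mul_ne_zero h1 h2
  have hX : (X : ℂ[X]) ≠ 0 := X_ne_zero
  rw [roots_mul (mul_ne_zero hX h12), roots_mul h12, roots_X, roots_X_sub_C, roots_X_add_C]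
  rfl

/-- **THE SPECTRUM OF `T_A` IS `{0, 2i|A|, −2i|A|}`** (`|A| = √(A·A)`; Mathlib `Matrix.mem_spectrum_iff_isRoot_charpoly`) —
the set of eigenvalues of `−ad(iA)` (equivalently of `ad(iA)`: the set is symmetric under `λ ↦ −λ`) on `su(2)` in print's
coordinates. [cite: Balaban1985UV3, p. 260] -/
theorem spectrum_TA (A : Fin 3 → ℝ) :
    spectrum ℂ (((2 : ℝ) • crossMatrix A).map (algebraMap ℝ ℂ)) =
      {0, ((2 * Real.sqrt (dotProduct A A) : ℝ) : ℂ) * I, -(((2 * Real.sqrt (dotProduct A A) : ℝ) : ℂ) * I)} := by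
  have hpos : 0 ≤ dotProduct A A := by
    rw [dotProduct, Fin.sum_univ_three]; nlinarith [sq_nonneg (A 0), sq_nonneg (A 1), sq_nonneg (A 2)]
  have hA : dotProduct A A = Real.sqrt (dotProduct A A) ^ 2 := (Real.sq_sqrt hpos).symm
  have hne : (((2 : ℝ) • crossMatrix A).map (algebraMap ℝ ℂ)).charpoly ≠ 0 := (Matrix.charpoly_monic _).ne_zero
  ext μ
  rw [Matrix.mem_spectrum_iff_isRoot_charpoly, ← mem_roots hne, roots_charpoly_TA hA]
  simp

/-- For `A ≠ 0` the three eigenvalues `0, 2i|A|, −2i|A|` are pairwise distinct (simple spectrum). [cite: Balaban1985UV3, p. 260] -/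
theorem eigenvalues_TA_distinct {r : ℝ} (hr : r ≠ 0) :
    (0 : ℂ) ≠ ((2 * r : ℝ) : ℂ) * I ∧ (0 : ℂ) ≠ -(((2 * r : ℝ) : ℂ) * I) ∧
      ((2 * r : ℝ) : ℂ) * I ≠ -(((2 * r : ℝ) : ℂ) * I) := by
  have h2r : ((2 * r : ℝ) : ℂ) ≠ 0 := Complex.ofReal_ne_zero.mpr (mul_ne_zero two_ne_zero hr)
  have hz : ((2 * r : ℝ) : ℂ) * I ≠ 0 := mul_ne_zero h2r I_ne_zero
  refine ⟨hz.symm, (neg_ne_zero.mpr hz).symm, ?_⟩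
  intro h
  have : (2 : ℂ) * (((2 * r : ℝ) : ℂ) * I) = 0 := by linear_combination h
  exact hz (by simpa using this)

end Spectrum

/-! ## §3  The loop of `B13HaarSigma` §3 closed at the example: `σrel(T_A) = φ(0)φ(2i|A|)φ(−2i|A|) = ∏_λ φ(λ)` -/

section Loop

open Complex

/-- Cast of the printed value: `((sin s/s)² : ℝ) = (sin s/s)²` in `ℂ`. [folklore] -/
private theorem ofReal_sin_div_sq (s : ℝ) : (((Real.sin s / s) ^ 2 : ℝ) : ℂ) = (Complex.sin s / s) ^ 2 := by
  rw [Complex.ofReal_pow, Complex.ofReal_div, Complex.ofReal_sin]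

/-- **`σrel(T_A) = φ(0)·φ(2i|A|)·φ(−2i|A|)` for `A ≠ 0`** — the determinant `det φ(T_A)` (sibling `sigmaRel_su2`:
`= (sin|A|/|A|)²`) equals the product of `φ` over the three eigenvalues of §2 (audit module `B13HaarSigma.su2_scalar_check`:
`φ(0)φ(2ir)φ(−2ir) = (sin r/r)²`): the two independently computed values of the p. 260 example agree. [cite: Balaban1985UV3, p. 260] -/
theorem sigmaRel_TA_eq_phi_mul {A : Fin 3 → ℝ} (hA : A ≠ 0) :
    sigmaRel (((2 : ℝ) • crossMatrix A).map (algebraMap ℝ ℂ)) =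
      phi (0 : ℂ) * (phi (2 * (Real.sqrt (dotProduct A A) : ℂ) * I) * phi (-(2 * (Real.sqrt (dotProduct A A) : ℂ) * I))) := by
  have hpos : 0 < dotProduct A A := by
    rw [dotProduct, Fin.sum_univ_three]
    have h : A 0 ≠ 0 ∨ A 1 ≠ 0 ∨ A 2 ≠ 0 := by
      by_contra hc
      push Not at hc
      apply hA
      funext i
      fin_cases i
      · exact hc.1
      · exact hc.2.1
      · exact hc.2.2
    rcases h with h | h | h <;> nlinarith [sq_nonneg (A 0), sq_nonneg (A 1), sq_nonneg (A 2), sq_pos_of_ne_zero h]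
  have hs : Real.sqrt (dotProduct A A) ≠ 0 := (Real.sqrt_pos.mpr hpos).ne'
  rw [sigmaRel_su2 hA, su2_scalar_check hs, ofReal_sin_div_sq]

/-- **`σrel(T_A) = ∏_{λ ∈ roots charpoly(T_A)} φ(λ)`** (multiset product, multiplicities included) FOR EVERY `A` — at
`A = 0`: `charpoly = X³`, `σrel(0) = φ(0)³ = 1`; at `A ≠ 0`: §2 + `sigmaRel_TA_eq_phi_mul`.  This is «the general
`det φ(∓ad A) = Π_λ φ(λ)` over the eigenvalues» of `B13HaarSigma` §3 AT THE MATRIX `T_A`; the general power-series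
statement is p28's line (not re-proved here). [cite: Balaban1985UV3, p. 260] -/
theorem sigmaRel_TA_eq_prod_roots (A : Fin 3 → ℝ) :
    sigmaRel (((2 : ℝ) • crossMatrix A).map (algebraMap ℝ ℂ)) =
      ((((2 : ℝ) • crossMatrix A).map (algebraMap ℝ ℂ)).charpoly.roots.map phi).prod := by
  have hpos : 0 ≤ dotProduct A A := by
    rw [dotProduct, Fin.sum_univ_three]; nlinarith [sq_nonneg (A 0), sq_nonneg (A 1), sq_nonneg (A 2)]
  have hAA : dotProduct A A = Real.sqrt (dotProduct A A) ^ 2 := (Real.sq_sqrt hpos).symm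
  rw [roots_charpoly_TA hAA]
  by_cases hA : A = 0
  · subst hA
    have h0 : Real.sqrt (dotProduct (0 : Fin 3 → ℝ) 0) = 0 := by simp [dotProduct]
    rw [h0, sigmaRel_su2_zero]
    simp [phi_zero]
  · rw [sigmaRel_TA_eq_phi_mul hA]
    simp only [Multiset.map_cons, Multiset.map_singleton, Multiset.prod_cons, Multiset.prod_singleton,
      Multiset.insert_eq_cons]
    push_cast
    ring_nf

end Loop

/-! ## §4  (v1.1) BY NAME from p28's `B13SigmaRelEigenvalues`: the general `det φ(T) = ∏_λ φ(λ)` and the printed value a third way -/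

section ByName

open Complex

/-- `σrel(T_A) = ∏_{λ ∈ roots charpoly(T_A)} φ(λ)` as the `T = T_A` instance of p28's general `B13SigmaRelEigenvalues.sigmaRel_eq_prod_roots`
([Rossmann2002] §1.2 Lemma 6 with multiplicities for the entire function `φ`) — the same statement as §3's
`sigmaRel_TA_eq_prod_roots`, now by name (one line). [cite: Balaban1985UV3, p. 260] -/
theorem sigmaRel_TA_eq_prod_roots' (A : Fin 3 → ℝ) :
    sigmaRel (((2 : ℝ) • crossMatrix A).map (algebraMap ℝ ℂ)) =
      ((((2 : ℝ) • crossMatrix A).map (algebraMap ℝ ℂ)).charpoly.roots.map fun μ => phi μ).prod :=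
  B13SigmaRelEigenvalues.sigmaRel_eq_prod_roots _

/-- **Print's `σ(A)/σ₀ = (sin|A|/|A|)²` A THIRD WAY: §2's eigenvalue dictionary `roots charpoly(T_A) = {0, ±2i|A|}` fed into p28's
`B13SigmaRelEigenvalues.sigmaRel_eq_sin_sq_of_roots`** (`A ≠ 0`; first way: `B13HaarSigma.su2_scalar_check` + the recorded dictionary,
second way: the sibling's `sigmaRel_su2` by the cubic relation). [cite: Balaban1985UV3, p. 260] -/
theorem sigmaRel_TA_eq_sin_sq_byRoots {A : Fin 3 → ℝ} (hA : A ≠ 0) :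
    sigmaRel (((2 : ℝ) • crossMatrix A).map (algebraMap ℝ ℂ)) =
      (Complex.sin (Real.sqrt (dotProduct A A)) / Real.sqrt (dotProduct A A)) ^ 2 := by
  have hpos : 0 < dotProduct A A := by
    rw [dotProduct, Fin.sum_univ_three]
    have h : A 0 ≠ 0 ∨ A 1 ≠ 0 ∨ A 2 ≠ 0 := by
      by_contra hc
      push Not at hc
      apply hA
      funext i
      fin_cases i
      · exact hc.1
      · exact hc.2.1
      · exact hc.2.2
    rcases h with h | h | h <;> nlinarith [sq_nonneg (A 0), sq_nonneg (A 1), sq_nonneg (A 2), sq_pos_of_ne_zero h]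
  have hs : Real.sqrt (dotProduct A A) ≠ 0 := (Real.sqrt_pos.mpr hpos).ne'
  have hAA : dotProduct A A = Real.sqrt (dotProduct A A) ^ 2 := (Real.sq_sqrt hpos.le).symm
  refine B13SigmaRelEigenvalues.sigmaRel_eq_sin_sq_of_roots _ hs ?_
  rw [roots_charpoly_TA hAA]
  push_cast
  ring_nf

end ByName

end Literature.MathematicalPhysics.QuantumFieldTheory.Balaban1983to89.B10Eq18SigmaSU2Eigenvalues

end
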